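import Literature.NumberTheory.DiophantineGeometry.AbcShapeFourthMoment
import Literature.NumberTheory.DiophantineGeometry.AbcShapeSubBox
import HarnessLib

/-!
# The fourth-moment bound with a set of saved variables (BBLT Prop. 3.1, (3.2) with `∏_{j ∣ i} A_i`)

The general form of the additive-energy bound in [BernertEtAl2024, Prop. 3.1 (arXiv v2), (3.4)]:
for the value family `U = (c ∏ᵢ xᵢ^{i+1})_{x ∈ box X}` and a set `S` of coordinates whose
exponents `i + 1` are all multiples of some `e ≥ 2` (in the source: `S = {i : j ∣ i}`, `e = j`),

> `E₄(U) · ∏_{i ∈ S} Xᵢ ≤ 3 D^{3d+1} · (#box X)³` (`AbcShapes.energy4_mul_prod_le`),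

i.e. `∫ |S₁|⁴ ≪ X^ε A³ / ∏_{i ∈ S} A_i`. The proof is that of `AbcShapeFourthMoment.energy4_le`
(Cauchy–Schwarz in the variables off `S` via `FourierCount.card_filter_add_eq_add_le`, then the
diagonal / off-diagonal count), with two changes taken from the source: the variables in `S` enter
through `W(s) = ∏_{i∈S} sᵢ^{i+1} = u(s)^e`, `u(s) = ∏_{i∈S} sᵢ^{(i+1)/e}`, so the off-diagonal
equation is `K (u'^e - u^e) = n` in the values `u` (at most `2τ(|n|)` pairs of values,
`card_pairs_pow_sub_pow_le`, each value with `≤ D^d` preimages), and the diagonal is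
`W(s) = W(s')` (at most `#B_S · D^d` pairs). Sub-boxes with frozen coordinates
(`AbcShapes.subBox`, file `AbcShapeSubBox`) replace the `insertNth` bookkeeping. Theorems 1.2/1.3 of the source (named
facts of `AbcExceptionalSetBounds`) are NOT proved here.

## References

* [BernertEtAl2024] C. Bernert, T. Browning, J. D. Lichtman, J. Teräväinen, *Bounds on the
  exceptional set in the abc conjecture*, arXiv:2410.12234v2, Proposition 3.1, (3.4).
* [Bernert2025] C. Bernert, *The exceptional set in the abc conjecture*, arXiv:2506.13364,
  Remark after the proof of Theorem 1.
-/

noncomputable section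

open Finset

namespace Literature.NumberTheory.DiophantineGeometry

namespace AbcShapes

/-! ### The fourth moment with a saved set -/

/-- **Fourth-moment bound with a set of saved variables** [BernertEtAl2024, (3.4)]: for `c ≥ 1`, a
box `X` with positive parameters, a set `S` of coordinates with `e ∣ i + 1` (`i ∈ S`) for some
`e ≥ 2`, and `D` bounding `τ(m)` for `1 ≤ m ≤ c ∏ (2Xᵢ)^{i+1}`:
`E₄(U) · ∏_{i∈S} Xᵢ ≤ 3 D^{3d+1} (#box X)³`. [cite: BernertEtAl2024, Proposition 3.1] -/
theorem energy4_mul_prod_le {d : ℕ} {c : ℕ} (hc : 0 < c) (X : Fin d → ℕ) (hX : ∀ i, 0 < X i)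
    (S : Finset (Fin d)) {e : ℕ} (he : 2 ≤ e) (hS : ∀ i ∈ S, e ∣ (i : ℕ) + 1) {D : ℕ}
    (hD : ∀ m : ℕ, m ≠ 0 → m ≤ c * shapeVal (fun i => 2 * X i) → m.divisors.card ≤ D) :
    energy4 c X * ∏ i ∈ S, X i ≤ 3 * D ^ (3 * d + 1) * (dyadicBox X).card ^ 3 := by
  classical
  -- notation
  set box := dyadicBox X with hbox
  set BR : Finset (Fin d → ℕ) := subBox S X with hBR
  set BS : Finset (Fin d → ℕ) := subBox Sᶜ X with hBS
  set φ : (Fin d → ℕ) → ℤ := vals c with hφ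
  set ψ : (Fin d → ℕ) → (Fin d → ℕ) → ℤ := fun r s => vals c (mergeOn S r s) with hψ
  have hN : box.card = BR.card * BS.card := by
    rw [hbox, hBR, hBS, card_subBox Sᶜ X, compl_compl]; exact (card_subBox_mul S X).symm
  have hsv : ∀ s : Fin d → ℕ, shapeVal s = offVal S s * onVal S s := fun s => by
    have h : mergeOn S s s = s := funext fun i => by simp [mergeOn]
    rw [← shapeVal_mergeOn S s s, h]
  have hBRbox : BR ⊆ box := subBox_subset hX
  have hBSbox : BS ⊆ box := subBox_subset hX
  have hboxpos : ∀ y ∈ box, ∀ i, 0 < y i := fun y hy i =>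
    lt_of_lt_of_le (hX i) ((mem_dyadicBox.mp hy) i).1
  -- values on the box are positive and bounded by `T = c · V(2X)`
  set T : ℕ := c * shapeVal (fun i => 2 * X i) with hT
  have hval_le : ∀ y ∈ box, shapeVal y ≤ shapeVal (fun i => 2 * X i) := fun y hy =>
    shapeVal_mono fun i => ((mem_dyadicBox.mp hy) i).2.le
  have hval_T : ∀ y ∈ box, c * shapeVal y ≤ T := fun y hy => Nat.mul_le_mul_left _ (hval_le y hy)
  have hval_pos : ∀ y ∈ box, 0 < shapeVal y := fun y hy => shapeVal_pos (hboxpos y hy)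
  have hD1 : 1 ≤ D := by
    have h1 : (1 : ℕ) ≤ T := Nat.mul_pos hc (shapeVal_pos fun i => by have := hX i; omega)
    simpa using hD 1 one_ne_zero h1
  have hDpow : ∀ {a b : ℕ}, a ≤ b → D ^ a ≤ D ^ b := fun h => Nat.pow_le_pow_right hD1 h
  -- `onVal`, `uVal`, `offVal` on the sub-boxes: nonzero, `≤ T`, hence `τ ≤ D`
  have honW : ∀ s ∈ BS, onVal S s ≠ 0 ∧ (onVal S s).divisors.card ≤ D := by
    intro s hs
    have hs' := hBSbox hs
    have hdvd : onVal S s ∣ shapeVal s := ⟨offVal S s, by rw [hsv s, mul_comm]⟩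
    have h0 : onVal S s ≠ 0 := fun h => (hval_pos s hs').ne' (Nat.eq_zero_of_zero_dvd (h ▸ hdvd))
    exact ⟨h0, hD _ h0 ((Nat.le_of_dvd (hval_pos s hs') hdvd).trans
      ((Nat.le_mul_of_pos_left _ hc).trans (hval_T s hs')))⟩
  have honU : ∀ s ∈ BS, uVal S e s ≠ 0 ∧ (uVal S e s).divisors.card ≤ D := by
    intro s hs
    obtain ⟨h0, -⟩ := honW s hs
    have hs' := hBSbox hs
    have hpow : onVal S s = uVal S e s ^ e := onVal_eq_uVal_pow hS s
    have hu0 : uVal S e s ≠ 0 := fun h => h0 (by rw [hpow, h, zero_pow (by omega)])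
    have hdvd : uVal S e s ∣ onVal S s := by rw [hpow]; exact dvd_pow_self _ (by omega)
    have hdvd' : onVal S s ∣ shapeVal s := ⟨offVal S s, by rw [hsv s, mul_comm]⟩
    exact ⟨hu0, hD _ hu0 ((Nat.le_of_dvd (hval_pos s hs') (hdvd.trans hdvd')).trans
      ((Nat.le_mul_of_pos_left _ hc).trans (hval_T s hs')))⟩
  have hψ_eq : ∀ (r s : Fin d → ℕ), ψ r s = (c : ℤ) * offVal S r * onVal S s := by
    intro r s; simp only [hψ, vals, shapeVal_mergeOn]; push_cast; ring
  /- Step 1: `E₄ ≤` the left-hand side of the fibring lemma -/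
  have h1 : energy4 c X ≤ (((box ×ˢ (BR ×ˢ BS)) ×ˢ (box ×ˢ (BR ×ˢ BS))).filter
      (fun t => φ t.1.1 + ψ t.1.2.1 t.1.2.2 = φ t.2.1 + ψ t.2.2.1 t.2.2.2)).card := by
    rw [energy4, mixedEnergy, coinc]
    refine card_le_card_of_injOn
      (fun t => ((t.1.1, (freezeOn S X t.1.2, freezeOn Sᶜ X t.1.2)),
        (t.2.1, (freezeOn S X t.2.2, freezeOn Sᶜ X t.2.2))))
      (fun t ht => ?_) (fun t ht t' ht' h => ?_)
    · obtain ⟨hmem, heq⟩ := mem_filter.mp (mem_coe.mp ht)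
      simp only [mem_product] at hmem
      obtain ⟨⟨hx, hy⟩, hx', hy'⟩ := hmem
      refine mem_coe.mpr (mem_filter.mpr ⟨?_, ?_⟩)
      · simp only [mem_product]
        exact ⟨⟨hx, freezeOn_mem_subBox S hy, freezeOn_mem_subBox Sᶜ hy⟩, hx',
          freezeOn_mem_subBox S hy', freezeOn_mem_subBox Sᶜ hy'⟩
      · simp only [hψ, hφ, mergeOn_freezeOn]
        exact heq
    · simp only [Prod.mk.injEq] at h
      obtain ⟨⟨h11, h12, h13⟩, h21, h22, h23⟩ := h
      have hy : t.1.2 = t'.1.2 := by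
        rw [← mergeOn_freezeOn S X t.1.2, ← mergeOn_freezeOn S X t'.1.2, h12, h13]
      have hy' : t.2.2 = t'.2.2 := by
        rw [← mergeOn_freezeOn S X t.2.2, ← mergeOn_freezeOn S X t'.2.2, h22, h23]
      exact Prod.ext (Prod.ext h11 hy) (Prod.ext h21 hy')
  /- Step 2: the fibring lemma -/
  have h2 := FourierCount.card_filter_add_eq_add_le box BR BS φ ψ
  set NN := (BR ×ˢ ((box ×ˢ BS) ×ˢ (box ×ˢ BS))).filter
    (fun t => φ t.2.1.1 + ψ t.1 t.2.1.2 = φ t.2.2.1 + ψ t.1 t.2.2.2) with hNN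
  /- Step 3: the diagonal `W(s) = W(s')` -/
  have hW2 : ((BS ×ˢ BS).filter (fun q => onVal S q.1 = onVal S q.2)).card ≤ BS.card * D ^ d := by
    rw [card_eq_sum_card_fiberwise (f := Prod.fst) (t := BS) (fun q hq => by
      exact mem_coe.mpr (mem_product.mp (mem_filter.mp (mem_coe.mp hq)).1).1)]
    calc _ ≤ ∑ s ∈ BS, D ^ d := by
          refine sum_le_sum fun s hs => ?_
          obtain ⟨hW0, hWD⟩ := honW s hs
          calc _ ≤ (BS.filter (fun s' => onVal S s' = onVal S s)).card := by
                refine card_le_card_of_injOn Prod.snd (fun q hq => ?_) (fun q hq q' hq' h => ?_)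
                · obtain ⟨hq1, hq2⟩ := mem_filter.mp (mem_coe.mp hq)
                  obtain ⟨hqq, heq⟩ := mem_filter.mp hq1
                  refine mem_coe.mpr (mem_filter.mpr ⟨(mem_product.mp hqq).2, ?_⟩)
                  rw [← heq, hq2]
                · have e1 := (mem_filter.mp (mem_coe.mp hq)).2
                  have e2 := (mem_filter.mp (mem_coe.mp hq')).2
                  exact Prod.ext (e1.trans e2.symm) h
            _ ≤ (onVal S s).divisors.card ^ d := by
                rw [hBS]
                exact card_subBox_filter_dvd_le Sᶜ X hW0 _ fun s' _ hs'eq i hi => by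
                  rw [← hs'eq]; exact dvd_onVal S s' (by rwa [mem_compl, not_not] at hi)
            _ ≤ D ^ d := Nat.pow_le_pow_left hWD d
      _ = BS.card * D ^ d := by rw [sum_const, smul_eq_mul]
  have h3 : (NN.filter (fun t => onVal S t.2.1.2 = onVal S t.2.2.2)).card ≤
      BR.card * (BS.card * D ^ d) * energy2 c X := by
    refine le_trans ?_ (Nat.mul_le_mul (Nat.mul_le_mul_left BR.card hW2) le_rfl)
    rw [energy2, coinc, ← card_product, ← card_product]
    refine card_le_card_of_injOn (fun t => ((t.1, (t.2.1.2, t.2.2.2)), (t.2.1.1, t.2.2.1)))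
      (fun t ht => ?_) (fun t ht t' ht' h => ?_)
    · obtain ⟨hN', hss⟩ := mem_filter.mp (mem_coe.mp ht)
      obtain ⟨hmem, heq⟩ := mem_filter.mp hN'
      simp only [mem_product] at hmem
      obtain ⟨hr, ⟨hy, hs⟩, hy', hs'⟩ := hmem
      refine mem_coe.mpr (mem_product.mpr ⟨mem_product.mpr ⟨hr, mem_filter.mpr
        ⟨mem_product.mpr ⟨hs, hs'⟩, hss⟩⟩, mem_filter.mpr ⟨mem_product.mpr ⟨hy, hy'⟩, ?_⟩⟩)
      rw [hψ_eq, hψ_eq, hss] at heq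
      simpa [hφ] using heq
    · simp only [Prod.mk.injEq] at h
      obtain ⟨⟨hr, hs, hs'⟩, hy, hy'⟩ := h
      exact Prod.ext hr (Prod.ext (Prod.ext hy hs) (Prod.ext hy' hs'))
  /- Step 4: off-diagonal `W(s) ≠ W(s')`, fibred over `(y, y')` -/
  have h4 : (NN.filter (fun t => ¬ onVal S t.2.1.2 = onVal S t.2.2.2)).card ≤
      box.card ^ 2 * (2 * D ^ (3 * d + 1)) := by
    rw [card_eq_sum_card_fiberwise (f := fun t => (t.2.1.1, t.2.2.1)) (t := box ×ˢ box)
      (fun t ht => by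
        obtain ⟨hN', -⟩ := mem_filter.mp (mem_coe.mp ht)
        have hmem := (mem_filter.mp hN').1
        simp only [mem_product] at hmem
        exact mem_coe.mpr (mem_product.mpr ⟨hmem.2.1.1, hmem.2.2.1⟩))]
    rw [sq, ← card_product]
    refine (sum_le_sum (fun yy hyy => ?_)).trans (by rw [sum_const, smul_eq_mul])
    obtain ⟨y, y'⟩ := yy
    obtain ⟨hy, hy'⟩ := mem_product.mp hyy
    set n : ℤ := φ y - φ y' with hn
    set F := (NN.filter (fun t => ¬ onVal S t.2.1.2 = onVal S t.2.2.2)).filter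
      (fun t => (t.2.1.1, t.2.2.1) = (y, y')) with hF
    have hFmem : ∀ t ∈ F, t.1 ∈ BR ∧ t.2.1.2 ∈ BS ∧ t.2.2.2 ∈ BS ∧ t.2.1.1 = y ∧ t.2.2.1 = y' ∧
        onVal S t.2.1.2 ≠ onVal S t.2.2.2 ∧
        (c : ℤ) * offVal S t.1 * ((onVal S t.2.2.2 : ℤ) - (onVal S t.2.1.2 : ℤ)) = n := by
      intro t ht
      obtain ⟨ht1, hyy'⟩ := mem_filter.mp ht
      obtain ⟨hN', hne⟩ := mem_filter.mp ht1
      obtain ⟨hmem, heq⟩ := mem_filter.mp hN'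
      simp only [mem_product] at hmem
      simp only [Prod.mk.injEq] at hyy'
      obtain ⟨rfl, rfl⟩ := hyy'
      refine ⟨hmem.1, hmem.2.1.2, hmem.2.2.2, rfl, rfl, hne, ?_⟩
      rw [hψ_eq, hψ_eq] at heq
      rw [hn]
      linear_combination (-1 : ℤ) * heq
    have hrpos : ∀ r ∈ BR, 0 < offVal S r := fun r hr =>
      prod_pos fun i _ => pow_pos (hboxpos r (hBRbox hr) i) _
    rcases eq_or_ne n 0 with hn0 | hn0
    · -- `n = 0` forces `W(s) = W(s')`: the fibre is empty
      have hFe : F = ∅ := by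
        refine eq_empty_of_forall_notMem fun t ht => ?_
        obtain ⟨hr, -, -, -, -, hne, heq⟩ := hFmem t ht
        rw [hn0] at heq
        have hA : (c : ℤ) * offVal S t.1 ≠ 0 := by
          have := hrpos t.1 hr; positivity
        have : (onVal S t.2.2.2 : ℤ) = onVal S t.2.1.2 := by
          have := (mul_eq_zero.mp heq).resolve_left hA; linarith
        exact hne (by exact_mod_cast this.symm)
      rw [hFe, card_empty]; exact Nat.zero_le _
    · -- `n ≠ 0`
      have hnD : n.natAbs.divisors.card ≤ D := by
        refine hD _ (Int.natAbs_ne_zero.mpr hn0) ?_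
        have h0y : (0 : ℤ) ≤ φ y := by simp only [hφ, vals]; positivity
        have h0y' : (0 : ℤ) ≤ φ y' := by simp only [hφ, vals]; positivity
        have hy1 : φ y ≤ (T : ℤ) := by simp only [hφ, vals]; exact_mod_cast hval_T y hy
        have hy2 : φ y' ≤ (T : ℤ) := by simp only [hφ, vals]; exact_mod_cast hval_T y' hy'
        have : (n.natAbs : ℤ) ≤ T := by
          rw [Int.natCast_natAbs, hn, abs_le]; constructor <;> linarith
        exact_mod_cast this
      -- fibre over `r`, confined to `BRn`
      set BRn := BR.filter (fun r => offVal S r ∣ n.natAbs) with hBRn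
      have hBRn : BRn.card ≤ D ^ d := by
        rw [hBRn, hBR]
        refine (card_subBox_filter_dvd_le S X (Int.natAbs_ne_zero.mpr hn0) _
          fun r _ hr i hi => (dvd_offVal S r hi).trans hr).trans (Nat.pow_le_pow_left hnD d)
      rw [card_eq_sum_card_fiberwise (f := fun t => t.1) (s := F) (t := BRn) (fun t ht => by
        obtain ⟨hr, -, -, -, -, -, heq⟩ := hFmem t (mem_coe.mp ht)
        refine mem_coe.mpr (mem_filter.mpr ⟨hr, ?_⟩)
        have h1 : ((offVal S t.1 : ℕ) : ℤ) ∣ n :=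
          ⟨(c : ℤ) * ((onVal S t.2.2.2 : ℤ) - (onVal S t.2.1.2 : ℤ)), by rw [← heq]; ring⟩
        have h2 : ((offVal S t.1 : ℕ) : ℤ).natAbs ∣ n.natAbs := Int.natAbs_dvd_natAbs.mpr h1
        rwa [Int.natAbs_natCast] at h2)]
      -- the values `u(s)` and the pairs of values with prescribed power difference
      set U : Finset ℕ := BS.image (uVal S e) with hU
      calc ∑ r ∈ BRn, (F.filter (fun t => t.1 = r)).card
          ≤ ∑ r ∈ BRn, 2 * D * (D ^ d * D ^ d) := by
            refine sum_le_sum fun r hr => ?_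
            have hrBR : r ∈ BR := (mem_filter.mp hr).1
            have hK : (c : ℤ) * offVal S r ≠ 0 := by have := hrpos r hrBR; positivity
            -- the pairs of values
            set Tg := (U ×ˢ U).filter (fun q => q.1 ≠ q.2 ∧
              (c : ℤ) * offVal S r * (((q.2 : ℕ) : ℤ) ^ e - ((q.1 : ℕ) : ℤ) ^ e) = n) with hTg
            have hTg : Tg.card ≤ 2 * D :=
              (card_pairs_pow_sub_pow_le he hK hn0 U).trans (Nat.mul_le_mul_left 2 hnD)
            -- fibre `F_r` over the value pairs
            rw [card_eq_sum_card_fiberwise (f := fun t => (uVal S e t.2.1.2, uVal S e t.2.2.2))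
              (s := F.filter (fun t => t.1 = r)) (t := Tg) (fun t ht => by
                obtain ⟨htF, htr⟩ := mem_filter.mp (mem_coe.mp ht)
                obtain ⟨-, hs, hs', -, -, hne, heq⟩ := hFmem t htF
                rw [htr] at heq
                refine mem_coe.mpr (mem_filter.mpr ⟨mem_product.mpr
                  ⟨mem_image_of_mem _ hs, mem_image_of_mem _ hs'⟩, ?_, ?_⟩)
                · intro hu
                  apply hne
                  rw [onVal_eq_uVal_pow hS, onVal_eq_uVal_pow hS]
                  exact congrArg (· ^ e) hu
                · rw [onVal_eq_uVal_pow hS, onVal_eq_uVal_pow hS] at heq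
                  push_cast at heq
                  exact heq)]
            calc ∑ q ∈ Tg, ((F.filter (fun t => t.1 = r)).filter
                  (fun t => (uVal S e t.2.1.2, uVal S e t.2.2.2) = q)).card
                ≤ ∑ q ∈ Tg, D ^ d * D ^ d := by
                  refine sum_le_sum fun q hq => ?_
                  obtain ⟨hqU, -, -⟩ := mem_filter.mp hq
                  obtain ⟨hq1, hq2⟩ := mem_product.mp hqU
                  obtain ⟨s₁, hs₁, hq1e⟩ := mem_image.mp hq1
                  obtain ⟨s₂, hs₂, hq2e⟩ := mem_image.mp hq2
                  have hv1 : q.1 ≠ 0 ∧ q.1.divisors.card ≤ D := by rw [← hq1e]; exact honU s₁ hs₁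
                  have hv2 : q.2 ≠ 0 ∧ q.2.divisors.card ≤ D := by rw [← hq2e]; exact honU s₂ hs₂
                  -- inject into pairs `(s, s')` with `u s = q.1`, `u s' = q.2`
                  refine le_trans (card_le_card_of_injOn
                    (t := (BS.filter (fun s => uVal S e s = q.1)) ×ˢ (BS.filter (fun s => uVal S e s = q.2)))
                    (fun t => (t.2.1.2, t.2.2.2)) (fun t ht => ?_) (fun t ht t' ht' h => ?_)) ?_
                  · obtain ⟨ht1, htq⟩ := mem_filter.mp (mem_coe.mp ht)
                    obtain ⟨htF, -⟩ := mem_filter.mp ht1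
                    obtain ⟨-, hs, hs', -, -, -, -⟩ := hFmem t htF
                    simp only [Prod.ext_iff] at htq
                    exact mem_coe.mpr (mem_product.mpr
                      ⟨mem_filter.mpr ⟨hs, htq.1⟩, mem_filter.mpr ⟨hs', htq.2⟩⟩)
                  · obtain ⟨ht1, -⟩ := mem_filter.mp (mem_coe.mp ht)
                    obtain ⟨htF, htr⟩ := mem_filter.mp ht1
                    obtain ⟨ht1', -⟩ := mem_filter.mp (mem_coe.mp ht')
                    obtain ⟨htF', htr'⟩ := mem_filter.mp ht1'
                    obtain ⟨-, -, -, hty, hty', -, -⟩ := hFmem t htF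
                    obtain ⟨-, -, -, hty2, hty2', -, -⟩ := hFmem t' htF'
                    simp only [Prod.mk.injEq] at h
                    refine Prod.ext (htr.trans htr'.symm)
                      (Prod.ext (Prod.ext ?_ h.1) (Prod.ext ?_ h.2))
                    · rw [hty, hty2]
                    · rw [hty', hty2']
                  · rw [card_product]
                    refine Nat.mul_le_mul ?_ ?_
                    · rw [hBS]
                      exact (card_subBox_filter_dvd_le Sᶜ X hv1.1 _ fun s _ hsq i hi => by
                        rw [← hsq]
                        exact dvd_uVal (by omega) hS s (by rwa [mem_compl, not_not] at hi)).trans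
                        (Nat.pow_le_pow_left hv1.2 d)
                    · rw [hBS]
                      exact (card_subBox_filter_dvd_le Sᶜ X hv2.1 _ fun s _ hsq i hi => by
                        rw [← hsq]
                        exact dvd_uVal (by omega) hS s (by rwa [mem_compl, not_not] at hi)).trans
                        (Nat.pow_le_pow_left hv2.2 d)
              _ = Tg.card * (D ^ d * D ^ d) := by rw [sum_const, smul_eq_mul]
              _ ≤ 2 * D * (D ^ d * D ^ d) := Nat.mul_le_mul_right _ hTg
        _ = BRn.card * (2 * D * (D ^ d * D ^ d)) := by rw [sum_const, smul_eq_mul]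
        _ ≤ D ^ d * (2 * D * (D ^ d * D ^ d)) := Nat.mul_le_mul_right _ hBRn
        _ = 2 * D ^ (3 * d + 1) := by ring
  /- Step 5: assemble -/
  have hE2 : energy2 c X ≤ box.card * D ^ d :=
    energy2_le hc X (fun z hz => hD _ (hval_pos z hz).ne'
      ((Nat.le_mul_of_pos_left _ hc).trans (hval_T z hz))) fun z hz => (hval_pos z hz).ne'
  have hsplit := card_filter_add_card_filter_not (s := NN) (fun t => onVal S t.2.1.2 = onVal S t.2.2.2)
  have hmain : energy4 c X ≤ BR.card * box.card ^ 2 * (3 * D ^ (3 * d + 1)) := by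
    calc energy4 c X ≤ _ := h1
      _ ≤ BR.card * NN.card := h2
      _ = BR.card * ((NN.filter (fun t => onVal S t.2.1.2 = onVal S t.2.2.2)).card +
            (NN.filter (fun t => ¬ onVal S t.2.1.2 = onVal S t.2.2.2)).card) := by rw [hsplit]
      _ ≤ BR.card * (BR.card * (BS.card * D ^ d) * (box.card * D ^ d) +
            box.card ^ 2 * (2 * D ^ (3 * d + 1))) := by
          gcongr
          exact h3.trans (Nat.mul_le_mul_left _ hE2)
      _ = BR.card * box.card ^ 2 * (D ^ (d + d) + 2 * D ^ (3 * d + 1)) := by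
          rw [hN]; ring
      _ ≤ BR.card * box.card ^ 2 * (D ^ (3 * d + 1) + 2 * D ^ (3 * d + 1)) :=
          Nat.mul_le_mul_left _ (Nat.add_le_add_right (Nat.pow_le_pow_right hD1 (by omega)) _)
      _ = BR.card * box.card ^ 2 * (3 * D ^ (3 * d + 1)) := by ring
  calc energy4 c X * ∏ i ∈ S, X i ≤ BR.card * box.card ^ 2 * (3 * D ^ (3 * d + 1)) * ∏ i ∈ S, X i :=
        Nat.mul_le_mul_right _ hmain
    _ = 3 * D ^ (3 * d + 1) * box.card ^ 2 * (BR.card * ∏ i ∈ S, X i) := by ring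
    _ = 3 * D ^ (3 * d + 1) * (dyadicBox X).card ^ 3 := by
        rw [hBR, card_subBox_mul S X, hbox]; ring

end AbcShapes

end Literature.NumberTheory.DiophantineGeometry
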